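import Summits.HubbardSuperconductivity.HubbardLadder.Bounds.AttractiveKineticCeilingGraph
import Summits.HubbardSuperconductivity.HubbardLadder.Bounds.AttractiveStiffnessCeilingDensity
import Summits.HubbardSuperconductivity.HubbardLadder.Bounds.StrongCouplingStiffnessCeilingTPrime
import HarnessLib

/-!
# Hubbard ladder — Bounds: density-proportional attractive ceilings, the `t–t'` class
# (bounds.tex Thm 9(vi), typed AND proved)

HONEST FRAMING (cell pub-hubbard): ladder R1–R4 with certified numbers; no claim on H/H₀. These
are bounds for a MODEL CLASS — the attractive `t–t'` Hubbard torus `hubbardTorusTT' L 1 t' U`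
(`t = 1`, any real `t'`, `U < 0`, square torus `(ℤ/Lℤ)²`, `L ≥ 3`, every pair number); no
materials claim. Companion text: `pub-hubbard/paper/bounds.tex` §Theorem 9; tables
`pub-hubbard/pub-hubbard-bounds/BOUNDS.md` (row T7) and `EXTREMISERS.md` §5b.

## What is proved (no `sorry`, no new axioms), `τ := 1 + |t'|`

* `pairBreaking_le_re_expect_hubbardTorusTT'` — the pair-breaking floor of
  `AttractivePairBreakingFloor.lean` on the two bond graphs of the `t–t'` torus (both of maximal
  degree `4`), added: `Re⟨φ, H^{tt'}(U) φ⟩ ≥ -4ωτ N + (U + 8τ(ω - ω⁻¹)) D(φ)` (`ω ≥ 1`).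
* `sectorEnergyTT'_two_mul_ge_pairBreaking`, `sectorEnergyTT'_two_mul_le_mul` — the brackets
  `U m - 64 τ² m/|U| ≤ E^{tt'}(U; 2m, S^z = 0) ≤ U m` (`m ≤ L²`).
* `two_mul_kinWeightTT'_le_attractive_density` — total kinetic energy of every unit ground
  state `ψ` of the `(2m, S^z = 0)` sector: `2(K_x + K_y + t'K_d)(ψ) ≤ 256 τ² m/|U|` (floor at
  `U/2` tested on `ψ` + paired upper bracket; `t' = 0` is Thm 9(ii)).
* `abs_kinWeightDiag_le_attractive_density` — the diagonal weight alone: `|K_d(ψ)| ≤ 128 τ m/|U|`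
  (chord inequality in `t'` towards `t' ± τ`, i.e. concavity of `t' ↦ E^{tt'}`, and the brackets
  there, `1 + |t' ± τ| ≤ 2τ`).
* `AttractiveKineticCeilingDensityTT'` / `…_holds` — the two displays as one node.
* `AttractiveStiffnessCeilingDensityTT'` / `…_holds` — **Thm 9(vi)**: every flux stiffness of
  the `(N_L, S^z = 0)` sector of `hubbardTorusTT' L 1 t' U` (`U < 0`, `δ ≥ -1`, every `L ≥ 3`)
  obeys `ρ_s ≤ 32 τ (1 + 2|t'|)(1 - δ)/|U|` (`x`-twist floor `ρ_s L² ≤ K_x + t'K_d` on `ψ` and on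
  the rotated state: `2ρ_s L² ≤ (K_x + K_y + t'K_d) + t'K_d`).
* `attractiveStiffnessCeilingDensity_of_TT'` — consistency: at `t' = 0` the node is Thm 9(iii).

Honest numbers: the constant is `60` at `t' = -1/4`, `73.4` at `t' = -0.35` (`32` at `t' = 0`);
informative only in the dilute BEC corner, loose by more than an order of magnitude against the
hard-core-boson heuristic `2 n τ²/|U|`; the content is the CLASS and the scaling `O(n t²/|U|)`.

References (keys of `lean/references.bib`): ScalapinoWhiteZhang1993 §II;
ParamekantiTrivediRanderia1998 eq. (3); HazraVermaRanderia2019 §III, App. G; XuEtAl2024 eq. (1);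
Nagaoka1966 §II; MicnasRanningerRobaszkiewicz1990 §IV; KomaTasaki1994 §1.
-/

noncomputable section

namespace Summit.HubbardSuperconductivity.HubbardLadder.Bounds

open Matrix Finset Real
open Literature.MathematicalPhysics.QuantumLattice
open Literature.MathematicalPhysics.QuantumFieldTheory
open Literature.Probability.LatticeModels
open Literature.MathematicalPhysics.QuantumLattice.ThermodynamicLimit
open scoped ComplexOrder ComplexConjugate

variable {L : ℕ} [NeZero L]

/-! ### The pair-breaking floor for the `t–t'` torus -/

omit [NeZero L] in
/-- `D(ψ) ≥ 0`. -/
theorem doubleOccExp_nonneg (ψ : Fock (Orb (FermionTorus 2 L))) : 0 ≤ doubleOccExp ψ := by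
  rw [doubleOccExp, re_expect_interaction_eq_sum]
  positivity

/-- **Pair-breaking floor, `t–t'` class** (`τ = 1 + |t'|`): for every `N`-particle unit vector
`φ` and every `ω ≥ 1`, `Re⟨φ, H^{tt'}(U) φ⟩ ≥ -4ωτN + (U + 8τ(ω - ω⁻¹)) D(φ)` — the graph floor
on the nearest-neighbour torus (`t = 1`) plus the graph floor on the diagonal torus (`t'`,
`U = 0`). -/
theorem pairBreaking_le_re_expect_hubbardTorusTT' (t' U : ℝ) {ω : ℝ} (hω : 1 ≤ ω) {N : ℕ}
    {φ : Fock (Orb (FermionTorus 2 L))} (hN : IsNParticle N φ) (hφ : star φ ⬝ᵥ φ = 1) :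
    -(4 * ω * (1 + |t'|) * N) + (U + 8 * (1 + |t'|) * (ω - ω⁻¹)) * doubleOccExp φ ≤
      (star φ ⬝ᵥ (hubbardTorusTT' L 1 t' U *ᵥ φ)).re := by
  have hΔ : ∀ v : FermionTorus 2 L,
      (Finset.univ.filter ((fermionTorusGraph 2 L).Adj v)).card ≤ 4 := fun v =>
    card_filter_fermionTorusGraph_adj_le v
  -- the diagonal bond graph has maximal degree `4` as well: the neighbours of `v` lie in
  -- `{v ± (e₀ + e₁), v ± (e₀ - e₁)}` (the Literature helper of this content is private)
  have hΔ' : ∀ v : FermionTorus 2 L,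
      (Finset.univ.filter ((fermionTorusDiagGraph L).Adj v)).card ≤ 4 := by
    intro v
    classical
    have hsub : (Finset.univ.filter ((fermionTorusDiagGraph L).Adj v)).image
        FermionTorus.toTorusSite ⊆
        (Finset.univ : Finset (Fin 2 × Bool)).image fun p =>
          if p.2 then v.toTorusSite + torusDiagJump L p.1
          else v.toTorusSite - torusDiagJump L p.1 := by
      intro z hz
      obtain ⟨w, hw, rfl⟩ := Finset.mem_image.1 hz
      have hadj : (torusDiagGraph L).Adj v.toTorusSite w.toTorusSite :=
        (Finset.mem_filter.1 hw).2
      rw [torusDiagGraph, SimpleGraph.fromRel_adj] at hadj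
      obtain ⟨-, ⟨s, h⟩ | ⟨s, h⟩⟩ := hadj
      · exact Finset.mem_image.2 ⟨(s, true), Finset.mem_univ _, by simp [h]⟩
      · refine Finset.mem_image.2 ⟨(s, false), Finset.mem_univ _, ?_⟩
        simp only [if_false, Bool.false_eq_true]
        rw [h, add_sub_cancel_right]
    calc (Finset.univ.filter ((fermionTorusDiagGraph L).Adj v)).card
        = ((Finset.univ.filter ((fermionTorusDiagGraph L).Adj v)).image
            FermionTorus.toTorusSite).card :=
          (Finset.card_image_of_injective _ FermionTorus.equivTorusSite.injective).symm
      _ ≤ ((Finset.univ : Finset (Fin 2 × Bool)).image fun p =>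
            if p.2 then v.toTorusSite + torusDiagJump L p.1
            else v.toTorusSite - torusDiagJump L p.1).card := Finset.card_le_card hsub
      _ ≤ (Finset.univ : Finset (Fin 2 × Bool)).card := Finset.card_image_le
      _ = 4 := by simp
  have h₁ := pairBreaking_le_re_expect_hamiltonian (fermionTorusGraph 2 L) hΔ 1 U hω hN hφ
  have h₂ := pairBreaking_le_re_expect_hamiltonian (fermionTorusDiagGraph L) hΔ' t' 0 hω hN hφ
  rw [← doubleOccExp] at h₁ h₂
  rw [abs_one] at h₁
  simp only [hubbardTorusTT', Matrix.add_mulVec, dotProduct_add, Complex.add_re]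
  push_cast at h₁ h₂ ⊢
  linarith

/-- **Sector floor, `t–t'` class (parametric)**: `ω ≥ 1` with `8τ(ω - ω⁻¹) ≥ -U`, sector
non-trivial: `E^{tt'}(U; N, M) ≥ -4ωτN`. -/
theorem pairBreaking_le_sectorEnergyTT' {t' U ω : ℝ} (hω : 1 ≤ ω)
    (hU : -U ≤ 8 * (1 + |t'|) * (ω - ω⁻¹)) (N : ℕ) (M : ℝ)
    (hK : ∃ ψ ∈ szSector (Λ := FermionTorus 2 L) N M, star ψ ⬝ᵥ ψ = 1) :
    -(4 * ω * (1 + |t'|) * N) ≤ sectorEnergyTT' L t' U N M := by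
  obtain ⟨ψ₀, hψ₀K, hψ₀⟩ := hK
  change _ ≤ (hubbardTorusTT' L 1 t' U).minEnergyOn (szSector N M)
  refine le_csInf ⟨_, ψ₀, hψ₀K, hψ₀, rfl⟩ ?_
  rintro E ⟨ψ, hψK, hψ1, rfl⟩
  have h := pairBreaking_le_re_expect_hubbardTorusTT' (L := L) t' U hω
    ((mem_szSector_iff N M ψ).1 hψK).1 hψ1
  have h5 := mul_nonneg (by linarith : 0 ≤ U + 8 * (1 + |t'|) * (ω - ω⁻¹))
    (doubleOccExp_nonneg ψ)
  linarith

/-- Arithmetic of the optimal weight `ω = a + a⁻¹`, `a = |U|/(8τ)`: `-4ωτ(2m) = U m - 64τ²m/|U|`. -/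
theorem pairBreaking_closed_form {U τ : ℝ} (hU : U < 0) (hτ : 0 < τ) (m : ℝ) :
    -(4 * (-U / (8 * τ) + (-U / (8 * τ))⁻¹) * τ * (2 * m)) = U * m - 64 * τ ^ 2 * m / (-U) := by
  have hU0 : -U ≠ 0 := by linarith
  field_simp
  ring

/-- **Lower energy bracket, `t–t'` class** (`U < 0`, `m ≤ L²`, `τ = 1 + |t'|`):
`E^{tt'}(U; 2m, S^z = 0) ≥ U m - 64 τ² m/|U|`. -/
theorem sectorEnergyTT'_two_mul_ge_pairBreaking (t' : ℝ) {U : ℝ} (hU : U < 0) {m : ℕ}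
    (hm : m ≤ L ^ 2) :
    U * m - 64 * (1 + |t'|) ^ 2 * m / (-U) ≤ sectorEnergyTT' L t' U (2 * m) 0 := by
  have hτ : 0 < 1 + |t'| := by positivity
  have ha : 0 < -U / (8 * (1 + |t'|)) := div_pos (neg_pos.2 hU) (by positivity)
  obtain ⟨hω, hωa⟩ := one_le_add_inv_and_le_sub_inv ha
  obtain ⟨ψ, h1, hgs⟩ := exists_unit_groundStateInSector_hubbardTorusTT' L 1 t' U hm
  have e : 8 * (1 + |t'|) * (-U / (8 * (1 + |t'|))) = -U := by
    field_simp
  have hUω : -U ≤ 8 * (1 + |t'|) *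
      (-U / (8 * (1 + |t'|)) + (-U / (8 * (1 + |t'|)))⁻¹ -
        (-U / (8 * (1 + |t'|)) + (-U / (8 * (1 + |t'|)))⁻¹)⁻¹) := by
    nlinarith [mul_le_mul_of_nonneg_left hωa hτ.le]
  have h := pairBreaking_le_sectorEnergyTT' hω hUω (2 * m) 0 ⟨ψ, hgs.1, h1⟩
  rw [← pairBreaking_closed_form hU hτ]
  refine le_trans (le_of_eq ?_) h
  push_cast
  ring

/-- **Upper energy bracket, `t–t'` class** (`m ≤ L²`): `E^{tt'}(U; 2m, S^z = 0) ≤ U m` — the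
paired configuration `|A↑ ∪ A↓⟩`, `#A = m`, lies in the sector and has energy `U m` (no hopping
term, nearest-neighbour or diagonal, has a diagonal matrix element). -/
theorem sectorEnergyTT'_two_mul_le_mul (t' U : ℝ) {m : ℕ} (hm : m ≤ L ^ 2) :
    sectorEnergyTT' L t' U (2 * m) 0 ≤ U * m := by
  classical
  have hcard : m ≤ (Finset.univ : Finset (FermionTorus 2 L)).card := by
    rwa [Finset.card_univ, NoGo.card_fermionTorus_two]
  obtain ⟨A, -, hA⟩ := Finset.exists_subset_card_eq hcard
  have hmem : (Pi.single (pairSet A A) (1 : ℂ) : Fock (Orb (FermionTorus 2 L))) ∈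
      szSector (Λ := FermionTorus 2 L) (2 * m) 0 := by
    rw [mem_szSector_two_mul_zero_iff]
    intro s hs
    by_cases hs0 : s = pairSet A A
    · subst hs0
      exact absurd ⟨by rw [upPart_pairSet, hA], by rw [downPart_pairSet, hA]⟩ hs
    · simp [hs0]
  have h1 : star (Pi.single (pairSet A A) (1 : ℂ) : Fock (Orb (FermionTorus 2 L))) ⬝ᵥ
      Pi.single (pairSet A A) 1 = 1 :=
    Literature.Computability.AlgebraicComplexity.star_single_dotProduct_single _
  have hle := minEnergyOn_le_rayleigh_of_mem (hubbardTorusTT'_isHermitian L 1 t' U) _ hmem h1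
  have hval : (star (Pi.single (pairSet A A) (1 : ℂ)) ⬝ᵥ
      (hubbardTorusTT' L 1 t' U *ᵥ Pi.single (pairSet A A) 1)).re = U * m := by
    have hnn : (star (Pi.single (pairSet A A) (1 : ℂ)) ⬝ᵥ
        (hamiltonian (fermionTorusGraph 2 L) 1 U *ᵥ Pi.single (pairSet A A) 1)).re =
          U * A.card := by
      convert star_single_pairSet_self_hamiltonian (fermionTorusGraph 2 L) 1 U A
    have hdg : (star (Pi.single (pairSet A A) (1 : ℂ)) ⬝ᵥ
        (hamiltonian (fermionTorusDiagGraph L) t' 0 *ᵥ Pi.single (pairSet A A) 1)).re =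
          0 * A.card := by
      convert star_single_pairSet_self_hamiltonian (fermionTorusDiagGraph L) t' 0 A
    simp only [hubbardTorusTT', Matrix.add_mulVec, dotProduct_add, Complex.add_re, hnn, hdg, hA]
    ring
  change (hubbardTorusTT' L 1 t' U).minEnergyOn _ ≤ _
  rw [hval] at hle
  exact hle

/-- Arithmetic of Thm 9(vi): `a = |U|/(16τ)`, `ω = a + a⁻¹`, `d ≥ 0`; the floor at `U/2`,
`-4ωτ(2m) + (U/2 + 8τ(ω - ω⁻¹)) d ≤ -k + (U/2) d`, and the upper bracket `-k + U d ≤ U m`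
give `k ≤ 256 τ² m/|U|`. -/
theorem kin_le_of_brackets_arith (k d U m τ : ℝ) (hU : U < 0) (hτ : 0 < τ) (hd : 0 ≤ d)
    (hωa : -U / (16 * τ) ≤ (-U / (16 * τ) + (-U / (16 * τ))⁻¹) -
      (-U / (16 * τ) + (-U / (16 * τ))⁻¹)⁻¹)
    (hlow : -(4 * (-U / (16 * τ) + (-U / (16 * τ))⁻¹) * τ * (2 * m)) +
      (U / 2 + 8 * τ * ((-U / (16 * τ) + (-U / (16 * τ))⁻¹) -
        (-U / (16 * τ) + (-U / (16 * τ))⁻¹)⁻¹)) * d ≤ -k + U / 2 * d)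
    (hup : -k + U * d ≤ U * m) : k ≤ 256 * τ ^ 2 * m / (-U) := by
  set a : ℝ := -U / (16 * τ) with ha
  have e : 8 * τ * a = -U / 2 := by
    rw [ha]
    field_simp
    ring
  have hcoef : 0 ≤ U / 2 + 8 * τ * ((a + a⁻¹) - (a + a⁻¹)⁻¹) := by
    nlinarith [mul_le_mul_of_nonneg_left hωa (by positivity : (0 : ℝ) ≤ 8 * τ)]
  have h5 := mul_nonneg hcoef hd
  have hU0 : -U ≠ 0 := by linarith
  have key : m * (16 * τ * (a + a⁻¹) + U) = 256 * τ ^ 2 * m / (-U) := by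
    rw [ha]
    field_simp
    ring
  rw [← key]
  linarith

/-- **Total kinetic energy, `t–t'` class** (`L ≥ 3`, `U < 0`, `m ≤ L²`, `τ = 1 + |t'|`): every
unit ground state `ψ` of `H^{tt'}(U)` in the sector `(2m, S^z = 0)` has
`⟨-T_{tt'}⟩_ψ = 2(K_x + K_y + t'K_d)(ψ) ≤ 256 τ² m/|U|` (`k := ⟨-T_{tt'}⟩_ψ`, `d := D(ψ)`:
`-k + U d = E(U) ≤ U m`, `-8ωτ m ≤ -k + (U/2) d`, so `k ≤ m(16τω + U) = 256 τ² m/|U|`). -/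
theorem two_mul_kinWeightTT'_le_attractive_density (hL : 3 ≤ L) (t' : ℝ) {U : ℝ}
    (hU : U < 0) {m : ℕ} (hm : m ≤ L ^ 2) {ψ : Fock (Orb (FermionTorus 2 L))}
    (hgs : IsGroundStateInSector (hubbardTorusTT' L 1 t' U) (2 * m) 0 ψ)
    (h1 : star ψ ⬝ᵥ ψ = 1) :
    2 * (kinWeightDir 0 ψ + kinWeightDir 1 ψ + t' * kinWeightDiag ψ) ≤
      256 * (1 + |t'|) ^ 2 * m / (-U) := by
  have hτ : 0 < 1 + |t'| := by positivity
  have ha : 0 < -U / (16 * (1 + |t'|)) := div_pos (neg_pos.2 hU) (by positivity)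
  obtain ⟨hω, hωa⟩ := one_le_add_inv_and_le_sub_inv ha
  have hup : (star ψ ⬝ᵥ (hubbardTorusTT' L 1 t' U *ᵥ ψ)).re ≤ U * m := by
    rw [re_expect_eq_sectorEnergyTT' hgs h1]
    exact sectorEnergyTT'_two_mul_le_mul t' U hm
  rw [re_expect_hubbardTorusTT'_eq_kin hL t' U ψ] at hup
  have hN : IsNParticle (2 * m) ψ := ((mem_szSector_iff _ _ ψ).1 hgs.1).1
  have hlow := pairBreaking_le_re_expect_hubbardTorusTT' (L := L) t' (U / 2) hω hN h1
  rw [re_expect_hubbardTorusTT'_eq_kin hL t' (U / 2) ψ] at hlow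
  push_cast at hlow
  exact kin_le_of_brackets_arith _ _ U m (1 + |t'|) hU hτ (doubleOccExp_nonneg ψ) hωa
    (by linarith) (by linarith)

/-- **The diagonal kinetic weight, `t–t'` class** (`L ≥ 3`, `U < 0`, `m ≤ L²`, `τ = 1 + |t'|`):
every unit ground state `ψ` of the `(2m, S^z = 0)` sector of `H^{tt'}(U)` has
`|K_d(ψ)| ≤ 128 τ m/|U|` (chords in `t'`: `E^{t,t'±τ} ≤ E^{tt'} ∓ 2τ K_d(ψ)`, with
`E^{tt'} ≤ U m` and `E^{t,t'±τ} ≥ U m - 64(2τ)² m/|U|`). -/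
theorem abs_kinWeightDiag_le_attractive_density (hL : 3 ≤ L) (t' : ℝ) {U : ℝ} (hU : U < 0)
    {m : ℕ} (hm : m ≤ L ^ 2) {ψ : Fock (Orb (FermionTorus 2 L))}
    (hgs : IsGroundStateInSector (hubbardTorusTT' L 1 t' U) (2 * m) 0 ψ)
    (h1 : star ψ ⬝ᵥ ψ = 1) : |kinWeightDiag ψ| ≤ 128 * (1 + |t'|) * m / (-U) := by
  set τ : ℝ := 1 + |t'| with hτ_def
  have hτ : 0 < τ := by positivity
  have hV : 0 < -U := neg_pos.2 hU
  have hm0 : (0 : ℝ) ≤ m := Nat.cast_nonneg m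
  have hup : sectorEnergyTT' L t' U (2 * m) 0 ≤ U * m := sectorEnergyTT'_two_mul_le_mul t' U hm
  have hcp := sectorEnergyTT'_le_sub_mul_kinWeightDiag hL hgs h1 (t' + τ)
  have hcm := sectorEnergyTT'_le_sub_mul_kinWeightDiag hL hgs h1 (t' - τ)
  have hfp := sectorEnergyTT'_two_mul_ge_pairBreaking (L := L) (t' + τ) hU hm
  have hfm := sectorEnergyTT'_two_mul_ge_pairBreaking (L := L) (t' - τ) hU hm
  have hτp : 1 + |t' + τ| ≤ 2 * τ := by
    have := abs_add_le t' τ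
    rw [abs_of_pos hτ] at this
    linarith
  have hτm : 1 + |t' - τ| ≤ 2 * τ := by
    have := abs_add_le t' (-τ)
    rw [← sub_eq_add_neg, abs_neg, abs_of_pos hτ] at this
    linarith
  have hsqp : (1 + |t' + τ|) ^ 2 ≤ (2 * τ) ^ 2 := by nlinarith [abs_nonneg (t' + τ)]
  have hsqm : (1 + |t' - τ|) ^ 2 ≤ (2 * τ) ^ 2 := by nlinarith [abs_nonneg (t' - τ)]
  have e : 2 * τ * (128 * τ * m / (-U)) = 64 * (2 * τ) ^ 2 * m / (-U) := by ring
  have hbp : 64 * (1 + |t' + τ|) ^ 2 * m / (-U) ≤ 2 * τ * (128 * τ * m / (-U)) := by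
    rw [e]
    exact div_le_div_of_nonneg_right (by nlinarith) hV.le
  have hbm : 64 * (1 + |t' - τ|) ^ 2 * m / (-U) ≤ 2 * τ * (128 * τ * m / (-U)) := by
    rw [e]
    exact div_le_div_of_nonneg_right (by nlinarith) hV.le
  have hplus : 2 * τ * kinWeightDiag ψ ≤ 2 * τ * (128 * τ * m / (-U)) := by
    have : 2 * (t' + τ - t') * kinWeightDiag ψ = 2 * τ * kinWeightDiag ψ := by ring
    linarith
  have hminus : 2 * τ * (-kinWeightDiag ψ) ≤ 2 * τ * (128 * τ * m / (-U)) := by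
    have : 2 * (t' - τ - t') * kinWeightDiag ψ = -(2 * τ * kinWeightDiag ψ) := by ring
    linarith
  have h2τ : 0 < 2 * τ := by positivity
  rw [abs_le]
  exact ⟨by linarith [le_of_mul_le_mul_left hminus h2τ], le_of_mul_le_mul_left hplus h2τ⟩

/-- **Thm 9(vi), kinetic part (PROVED below).** `L ≥ 3`, any real `t'`, `U < 0`, `m ≤ L²`,
`τ = 1 + |t'|`: every unit ground state `ψ` of the `(2m, S^z = 0)` sector of
`hubbardTorusTT' L 1 t' U` has `2(K_x + K_y + t'K_d)(ψ) ≤ 256 τ² m/|U|` and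
`|K_d(ψ)| ≤ 128 τ m/|U|`. kind: support (PROVED). Why it might fail: it cannot; informative
only for `|U| ≳ 32τ`. Sources: Nagaoka1966 §II; KomaTasaki1994 §1; XuEtAl2024 eq. (1); this
cell (Thm 9(i),(ii)). -/
@[conjecture] def AttractiveKineticCeilingDensityTT' : Prop :=
  ∀ (L : ℕ) [NeZero L], 3 ≤ L → ∀ (t' U : ℝ) (m : ℕ) (ψ : Fock (Orb (FermionTorus 2 L))),
    U < 0 → m ≤ L ^ 2 → IsGroundStateInSector (hubbardTorusTT' L 1 t' U) (2 * m) 0 ψ →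
    star ψ ⬝ᵥ ψ = 1 →
      2 * (kinWeightDir 0 ψ + kinWeightDir 1 ψ + t' * kinWeightDiag ψ) ≤
          256 * (1 + |t'|) ^ 2 * m / (-U) ∧
        |kinWeightDiag ψ| ≤ 128 * (1 + |t'|) * m / (-U)

/-- Proof of `AttractiveKineticCeilingDensityTT'`. -/
theorem attractiveKineticCeilingDensityTT'_holds : AttractiveKineticCeilingDensityTT' := by
  intro L _ hL t' U m ψ hU hm hgs h1
  exact ⟨two_mul_kinWeightTT'_le_attractive_density hL t' hU hm hgs h1,
    abs_kinWeightDiag_le_attractive_density hL t' hU hm hgs h1⟩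

/-- **Thm 9(vi) (density-proportional attractive stiffness ceiling, `t–t'` class; PROVED
below).** `L ≥ 3`, any real `t'`, `τ = 1 + |t'|`, `U < 0`, `δ ≥ -1`; `ρ_s > 0` a flux stiffness
of the `(N_L, S^z = 0)` sector of `hubbardTorusTT' L 1 t' U` (`ρ_s θ² ≤ E^{tt'}(θ) - E^{tt'}(0)`
for `|θ| ≤ θ₀`). Then `ρ_s ≤ 32 τ (1 + 2|t'|)(1 - δ)/|U|` — at every `L`, hence for every
thermodynamic-limit stiffness. kind: support (PROVED). Why it might fail: it cannot; it is
informative only in the dilute BEC corner. Sources: ScalapinoWhiteZhang1993 §II;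
HazraVermaRanderia2019 §III, App. G; XuEtAl2024 eq. (1); this cell. -/
@[conjecture] def AttractiveStiffnessCeilingDensityTT' : Prop :=
  ∀ (L : ℕ) [NeZero L], 3 ≤ L → ∀ (t' U δ ρs θ₀ : ℝ), -1 ≤ δ → U < 0 → 0 < ρs → 0 < θ₀ →
    (∀ θ : ℝ, |θ| ≤ θ₀ → ρs * θ ^ 2 ≤ fluxEnergyTT' L t' U δ θ - fluxEnergyTT' L t' U δ 0) →
      ρs ≤ 32 * (1 + |t'|) * (1 + 2 * |t'|) * (1 - δ) / (-U)

/-- **Proof of `AttractiveStiffnessCeilingDensityTT'`**: `x`-twist floors `ρ_s L² ≤ K_x + t'K_d`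
on a unit ground state `ψ` and on `Γ(r)ψ` (`K_y(Γ(r)ψ) = K_x(ψ)`, `K_d(Γ(r)ψ) = K_d(ψ)`), so
`2ρ_s L² ≤ (K_x + K_y + t'K_d)(Γ(r)ψ) + t'K_d(Γ(r)ψ) ≤ 128τ² m/|U| + |t'| · 128τ m/|U|`, and
`m = ⌊(1-δ)L²/2⌋ ≤ (1-δ)L²/2` (for `δ > 1`, `m = 0` contradicts `ρ_s > 0`). -/
theorem attractiveStiffnessCeilingDensityTT'_holds : AttractiveStiffnessCeilingDensityTT' := by
  intro L _ hL t' U δ ρs θ₀ hδ hU hρs hθ₀ hst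
  have hm : ⌊(1 - δ) * (L : ℝ) ^ 2 / 2⌋₊ ≤ L ^ 2 := NoGo.floor_pairNumber_le δ hδ L
  obtain ⟨ψ, h1, hgs⟩ := exists_unit_groundStateInSector_hubbardTorusTT' L 1 t' U hm
  set φ : Fock (Orb (FermionTorus 2 L)) :=
    fockMapOp (d4Orb (DihedralGroup.r 1 : DihedralGroup 4)) *ᵥ ψ with hφ_def
  have hφgs : IsGroundStateInSector (hubbardTorusTT' L 1 t' U)
      (2 * ⌊(1 - δ) * (L : ℝ) ^ 2 / 2⌋₊) 0 φ :=
    isGroundStateInSector_hubbardTorusTT'_rot hgs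
  have hφ1 : star φ ⬝ᵥ φ = 1 := by
    rw [hφ_def, star_fockMapOp_mulVec_dotProduct_self _ (d4Orb_bijective _).injective, h1]
  have hKy : kinWeightDir 1 φ = kinWeightDir 0 ψ := kinWeightDir_one_rot ψ
  have hKd : kinWeightDiag φ = kinWeightDiag ψ := kinWeightDiag_rot ψ
  have hfψ : ρs * (L : ℝ) ^ 2 ≤ kinWeightDir 0 ψ + t' * kinWeightDiag ψ := by
    have h := stiffnessTT'_mul_sq_le_kinetic_of_isGroundStateInSector hL t' U δ hρs hθ₀ hst hgs h1
    rw [sum_shiftKinWeight_eq_kinWeightDiag] at h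
    exact h.trans (le_of_eq rfl)
  have hfφ : ρs * (L : ℝ) ^ 2 ≤ kinWeightDir 0 φ + t' * kinWeightDiag φ := by
    have h := stiffnessTT'_mul_sq_le_kinetic_of_isGroundStateInSector hL t' U δ hρs hθ₀ hst hφgs hφ1
    rw [sum_shiftKinWeight_eq_kinWeightDiag] at h
    exact h.trans (le_of_eq rfl)
  rw [← hKy, ← hKd] at hfψ
  have hk := two_mul_kinWeightTT'_le_attractive_density hL t' hU hm hφgs hφ1
  have hd := abs_kinWeightDiag_le_attractive_density hL t' hU hm hφgs hφ1
  have htK : t' * kinWeightDiag φ ≤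
      |t'| * (128 * (1 + |t'|) * (⌊(1 - δ) * (L : ℝ) ^ 2 / 2⌋₊ : ℕ) / (-U)) :=
    calc t' * kinWeightDiag φ ≤ |t' * kinWeightDiag φ| := le_abs_self _
      _ = |t'| * |kinWeightDiag φ| := abs_mul _ _
      _ ≤ |t'| * (128 * (1 + |t'|) * (⌊(1 - δ) * (L : ℝ) ^ 2 / 2⌋₊ : ℕ) / (-U)) :=
        mul_le_mul_of_nonneg_left hd (abs_nonneg _)
  have hL2 : (0 : ℝ) < (L : ℝ) ^ 2 := by have := NeZero.pos L; positivity
  have hV : 0 < -U := neg_pos.2 hU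
  have hρL : 0 < ρs * (L : ℝ) ^ 2 := mul_pos hρs hL2
  by_cases hδ1 : δ ≤ 1
  · have hx : 0 ≤ (1 - δ) * (L : ℝ) ^ 2 / 2 := by nlinarith [hL2]
    have hmx : ((⌊(1 - δ) * (L : ℝ) ^ 2 / 2⌋₊ : ℕ) : ℝ) ≤ (1 - δ) * (L : ℝ) ^ 2 / 2 :=
      Nat.floor_le hx
    have hc : 0 ≤ 128 * (1 + |t'|) ^ 2 / (-U) + |t'| * (128 * (1 + |t'|) / (-U)) := by
      positivity
    have e1 : 256 * (1 + |t'|) ^ 2 * ((⌊(1 - δ) * (L : ℝ) ^ 2 / 2⌋₊ : ℕ) : ℝ) / (-U) +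
        2 * (|t'| * (128 * (1 + |t'|) * ((⌊(1 - δ) * (L : ℝ) ^ 2 / 2⌋₊ : ℕ) : ℝ) / (-U))) =
        2 * ((128 * (1 + |t'|) ^ 2 / (-U) + |t'| * (128 * (1 + |t'|) / (-U))) *
          ((⌊(1 - δ) * (L : ℝ) ^ 2 / 2⌋₊ : ℕ) : ℝ)) := by
      ring
    have e2 : (128 * (1 + |t'|) ^ 2 / (-U) + |t'| * (128 * (1 + |t'|) / (-U))) *
        ((1 - δ) * (L : ℝ) ^ 2 / 2) =
        2 * (32 * (1 + |t'|) * (1 + 2 * |t'|) * (1 - δ) / (-U) * (L : ℝ) ^ 2) := by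
      ring
    have key : ρs * (L : ℝ) ^ 2 ≤
        32 * (1 + |t'|) * (1 + 2 * |t'|) * (1 - δ) / (-U) * (L : ℝ) ^ 2 := by
      linarith [mul_le_mul_of_nonneg_left hmx hc]
    exact le_of_mul_le_mul_right key hL2
  · exfalso
    have hx : (1 - δ) * (L : ℝ) ^ 2 / 2 ≤ 0 := by nlinarith [not_le.1 hδ1, hL2]
    rw [Nat.floor_of_nonpos hx] at hk htK
    simp only [Nat.cast_zero, mul_zero, zero_div] at hk htK
    linarith

/-- **Consistency with Thm 9(iii)**: at `t' = 0` the node is `AttractiveStiffnessCeilingDensity`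
(`ρ_s ≤ 32(1 - δ)/|U|` for the nearest-neighbour torus). -/
theorem attractiveStiffnessCeilingDensity_of_TT' (h : AttractiveStiffnessCeilingDensityTT') :
    AttractiveStiffnessCeilingDensity := by
  intro L _ hL U δ ρs θ₀ hδ hU hρs hθ₀ hst
  have h' := h L hL 0 U δ ρs θ₀ hδ hU hρs hθ₀
    (by simpa only [fluxEnergyTT'_tPrime_zero] using hst)
  simpa only [abs_zero, add_zero, mul_zero, mul_one, one_mul] using h'

end Summit.HubbardSuperconductivity.HubbardLadder.Bounds

end
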